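import Summits.AnomalousDissipation.AnomalousDissipation.Theorems.SolenoidalFractalHomogenisationLagrangianStepSidebandXSidebandEnergy
import HarnessLib

/-!
# K1L_D (stmt-AnomalousDissipation-27980): (V_mod) flat stage, block (ss) — THE LINK FORCING OF A SINGLE REAL MODE PAIR IS SMALL
# (sideband slaving at the block `{ℓ, −ℓ}`; the second input of the generator regime T-G)
(helper; `--supports 27980 --as helper`; prover ad-sawtooth-k1loc-p1 g15; companion of `…VmodGenerator`; certifier's table
`Cruxes/LagrangianRenormalisationStep/Lines/onelevel-ss-regimes.md` v2, tool L-sb.)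

For the cell problem with `n ≠ 0` cells (carrier `W₁.cell n`, tensor `(1/n²)•𝔸`, `NearIso 𝔸 lo hi`, `lo > 0`) and an `L²` weakly divergence-free
datum `F` supported on `{ℓ, −ℓ}` (`ℓ ≠ 0`, `2|ℓ| < n`), the two-neighbour link forcing of the slow mode `ℓ` in the chain ODE
(`CellChain.hasDerivAt_modeRep`) obeys, at EVERY `s ∈ [0,T]`,

  `‖Σⱼ linkCoeffⱼ(ℓ,s) • P_ℓ(aⱼ y_{ℓ−Kⱼ}(s) + a′ⱼ y_{ℓ+Kⱼ}(s))‖ ≤ 32·(√|ℓ|²/n)²·(Σⱼ‖αⱼ‖)²·√(∫‖F‖²)/lo`   (`norm_linkForcing_le`):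

w1's bulk slaving `CellChain.fastEnergy_le_of_zero` at the block `{ℓ,−ℓ}` (gap `2π²·lo` by class-pair confinement
`Sideband.ae_classPair_of_ne_zero_cell`, exchange amplitude `8πξ‖F‖Σⱼ‖αⱼ‖`, `ξ = √|ℓ|²/n`) gives the sideband energy `≤ 64ξ²‖F‖²(Σ‖α‖)²/(π²lo²)`
(as in `Sideband.sideband_energy_le`, here for a general pair datum instead of the cosine mode), and the link strength is `4πξΣ‖α‖`.
With `lo ∝ ν` (the clause window) the bound is `∝ (|ℓ|/n)²/(ν·lo′)·‖F‖`: against the coarse rate `8π²·loT·|ℓ|²` the ratio is a constant, for every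
label.  `sorry`-free; NOT a proof of (ss), of the stub, of K1L_D or of AD; rung F-D1.A0.
-/

set_option linter.dupNamespace false

noncomputable section

namespace Summit.AnomalousDissipation.AnomalousDissipation.Theorems.SolenoidalFractalHomogenisation.LagrangianStep.VmodGen

open Set MeasureTheory Complex UnitAddTorus
open scoped InnerProductSpace
open Literature.Analysis Literature.Analysis.FunctionSpaces Literature.Analysis.FunctionSpaces.Torus
open Literature.Analysis.FluidPDE Literature.Analysis.FluidPDE.Torus Literature.Analysis.FluidPDE.LatticeShear
open Summit.AnomalousDissipation.AnomalousDissipation.Theorems.SolenoidalFractalHomogenisation.LagrangianStep.CellChain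
  (modeRep modeRep_zero continuousOn_modeRep linkCoeff norm_transversalProj_le fastEnergy_le_of_zero norm_sq_le_fastEnergy
   exists_energyRep_cell norm_latticeVec_ge_of_classPair_ne)
open Summit.AnomalousDissipation.AnomalousDissipation.Theorems.SolenoidalFractalHomogenisation.LagrangianStep.Sideband
  (slotAmp slotAmp_def conj_slotAmp classFreq norm_linkCoeff_le_sqrt pair_neighbours_not_mem ae_classPair_of_ne_zero_cell)

variable {k₀ : ℕ}

/-! ## §5 The link forcing of a single real mode pair is small: sideband slaving -/

/-- **THE LINK FORCING OF A PAIR DATUM.**  For the cell problem with `n ≠ 0` cells, tensor `(1/n²)•𝔸`, `NearIso 𝔸 lo hi`, `lo > 0`, and an `L²` weakly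
divergence-free datum `F` supported on `{ℓ, −ℓ}` (`ℓ ≠ 0`, `2|ℓ| < n`): at every `s ∈ [0,T]` the two-neighbour link forcing of the slow mode obeys
`‖LF(s)‖ ≤ 32·(√|ℓ|²/n)²·(Σⱼ‖αⱼ‖)²·√(∫‖F‖²)/lo` (sideband energy `≤ 64ξ²‖F‖²(Σ‖α‖)²/(π²lo²)` by `fastEnergy_le_of_zero`, times the link strength
`4πξΣ‖α‖`). [cite: BedrossianCotiZelati2017, §2] [cite: MeshalkinSinai1961, pp. 1700–1705] -/
theorem norm_linkForcing_le (W₁ : LatticeWord k₀) {n : ℕ} (hn : n ≠ 0) {T : ℝ} (hT : 0 < T) {𝔸 : Visc4 (Fin 3)} {lo hi : ℝ}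
    (h𝔸 : NearIso 𝔸 lo hi) (hlo : 0 < lo) {ℓ : Fin 3 → ℤ} (hℓ0 : ℓ ≠ 0) (hℓ : 2 * Real.sqrt (freqNormSq ℓ) < n)
    {F : UnitAddTorus (Fin 3) → EuclideanSpace ℝ (Fin 3)} (hF2 : MemLp F 2 volume) (hFdiv : FunctionSpaces.Torus.IsWeaklyDivFree F)
    (hsupp : ∀ k, k ≠ ℓ → k ≠ -ℓ → mFourierCoeff (FunctionSpaces.EuclideanSpace.complexify ∘ F) k = 0)
    {u : ℝ → UnitAddTorus (Fin 3) → EuclideanSpace ℝ (Fin 3)}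
    (h : IsWeakTensorPassiveVectorOn 0 T ((1 / (n : ℝ) ^ 2) • 𝔸) (W₁.cell n) F u)
    {s : ℝ} (hs : s ∈ Icc 0 T) :
    ‖∑ j, linkCoeff W₁ n ℓ j s • transversalProj ℓ
          ((Complex.exp ((W₁.phase j).φ * Complex.I) * (1 / (2 * ((2 * Real.pi * ‖latticeVec (W₁.phase j).m‖ : ℝ) : ℂ) * Complex.I))) •
              modeRep W₁ n ((1 / (n : ℝ) ^ 2) • 𝔸) F u (ℓ - fun i => (W₁.phase j).m i * n) s +
            (starRingEnd ℂ (Complex.exp ((W₁.phase j).φ * Complex.I)) *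
                (-(1 / (2 * ((2 * Real.pi * ‖latticeVec (W₁.phase j).m‖ : ℝ) : ℂ) * Complex.I)))) •
              modeRep W₁ n ((1 / (n : ℝ) ^ 2) • 𝔸) F u (ℓ + fun i => (W₁.phase j).m i * n) s)‖ ≤
      32 * (Real.sqrt (freqNormSq ℓ) / n) ^ 2 * (∑ j, ‖slotAmp W₁ j‖) ^ 2 * Real.sqrt (∫ x, ‖F x‖ ^ 2) / lo := by
  classical
  set 𝔹 := (1 / (n : ℝ) ^ 2) • 𝔸 with h𝔹def
  have hn0 : (0 : ℝ) < n := by exact_mod_cast Nat.pos_of_ne_zero hn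
  have hnpos : 0 < n := Nat.pos_of_ne_zero hn
  have h𝔹 : NearIso 𝔹 (1 / (n : ℝ) ^ 2 * lo) (1 / (n : ℝ) ^ 2 * hi) := h𝔸.smul (by positivity)
  have hlo' : 0 < 1 / (n : ℝ) ^ 2 * lo := by positivity
  have hFi : Integrable F volume := hF2.integrable one_le_two
  obtain ⟨E, Q, hE0, -, hEc, hEanti, hEac, hEae, -, -, hEd, hQdom, -⟩ := exists_energyRep_cell W₁ n hT h𝔹 hlo' hF2 hFdiv h
  have hne : ℓ ≠ -ℓ := fun h' => hℓ0 (by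
    funext i; have hi := congrFun h' i; simp only [Pi.neg_apply] at hi; have : ℓ i = 0 := by omega
    simpa using this)
  set W : Finset (Fin 3 → ℤ) := {ℓ, -ℓ} with hW
  have hℓW : ℓ ∈ W := by rw [hW]; exact Finset.mem_insert_self _ _
  -- support of the datum in the divisibility format
  have hsupp' : ∀ k, mFourierCoeff (FunctionSpaces.EuclideanSpace.complexify ∘ F) k ≠ 0 →
      (∀ i, (n : ℤ) ∣ k i - ℓ i) ∨ (∀ i, (n : ℤ) ∣ k i + ℓ i) := by
    intro k hk
    by_cases h1 : k = ℓ
    · left; intro i; rw [h1, sub_self]; exact dvd_zero _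
    · by_cases h2 : k = -ℓ
      · right; intro i; rw [h2, Pi.neg_apply, neg_add_cancel]; exact dvd_zero _
      · exact absurd (hsupp k h1 h2) hk
  -- the gap off the block, from class-pair confinement
  have hℓn : 2 * ‖Torus.latticeVec ℓ‖ ≤ n := by
    have e : ‖Torus.latticeVec ℓ‖ = Real.sqrt (freqNormSq ℓ) := by
      rw [← norm_latticeVec_sq', Real.sqrt_sq (norm_nonneg _)]
    rw [e]; exact hℓ.le
  have hgap : ∀ᵐ s ∂(volume.restrict (Ioo 0 T)), ∀ k : Fin 3 → ℤ, k ∉ W →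
      mFourierCoeff (EuclideanSpace.complexify ∘ u s) k ≠ 0 → 2 * Real.pi ^ 2 * lo ≤ 8 * Real.pi ^ 2 * (1 / (n : ℝ) ^ 2 * lo) * freqNormSq k := by
    filter_upwards [ae_classPair_of_ne_zero_cell W₁ hnpos h𝔸 hlo ℓ hF2 hsupp' h] with s hs k hkW hk
    have hmem := hs k hk
    rw [hW, Finset.mem_insert, Finset.mem_singleton, not_or] at hkW
    have hge := norm_latticeVec_ge_of_classPair_ne hmem hkW.1 hkW.2
    have hnn : 0 ≤ (n : ℝ) - ‖Torus.latticeVec ℓ‖ := by linarith [norm_nonneg (Torus.latticeVec ℓ)]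
    have hsq : ((n : ℝ) - ‖Torus.latticeVec ℓ‖) ^ 2 ≤ freqNormSq k := by
      rw [← norm_latticeVec_sq']; exact pow_le_pow_left₀ hnn hge 2
    have h4 : (n : ℝ) ^ 2 / 4 ≤ freqNormSq k := by nlinarith [norm_nonneg (Torus.latticeVec ℓ)]
    have e : 8 * Real.pi ^ 2 * (1 / (n : ℝ) ^ 2 * lo) * freqNormSq k = 8 * Real.pi ^ 2 * lo * (freqNormSq k / (n : ℝ) ^ 2) := by
      field_simp
    rw [e]
    have h4' : 1 / 4 ≤ freqNormSq k / (n : ℝ) ^ 2 := by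
      rw [le_div_iff₀ (by positivity)]; linarith
    nlinarith [Real.pi_pos, h4', mul_pos (mul_pos (by norm_num : (0:ℝ) < 8) (pow_pos Real.pi_pos 2)) hlo]
  have hdmin : 0 < 2 * Real.pi ^ 2 * lo := by positivity
  -- the exchange amplitude
  have hα : ∀ j : Fin k₀, ‖Complex.exp ((W₁.phase j).φ * Complex.I) * (1 / (2 * ((2 * Real.pi * ‖latticeVec (W₁.phase j).m‖ : ℝ) : ℂ) * Complex.I))‖ =
      ‖slotAmp W₁ j‖ := fun j => by rw [slotAmp_def]
  have hα' : ∀ j : Fin k₀, ‖starRingEnd ℂ (Complex.exp ((W₁.phase j).φ * Complex.I)) *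
      (-(1 / (2 * ((2 * Real.pi * ‖latticeVec (W₁.phase j).m‖ : ℝ) : ℂ) * Complex.I)))‖ = ‖slotAmp W₁ j‖ := fun j => by
    rw [← conj_slotAmp, Complex.norm_conj]
  have hxE : ∀ k, ∀ s ∈ Icc 0 T, ‖modeRep W₁ n 𝔹 F u k s‖ ≤ Real.sqrt (E 0) := by
    intro k s hs
    have h1 := norm_sq_le_fastEnergy W₁ n hT h hFi hEc hEae ∅ (Finset.notMem_empty k) s hs
    rw [Finset.sum_empty, sub_zero] at h1
    have h2 : E s ≤ E 0 := hEanti ⟨le_rfl, hT.le⟩ hs hs.1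
    rw [← Real.sqrt_sq (norm_nonneg (modeRep W₁ n 𝔹 F u k s))]
    exact Real.sqrt_le_sqrt (h1.trans h2)
  have hE0nn : 0 ≤ E 0 := by rw [hE0]; exact integral_nonneg fun x => sq_nonneg _
  set ξ := Real.sqrt (freqNormSq ℓ) / n with hξ
  have hξ0 : 0 ≤ ξ := by positivity
  set A : ℝ := 2 * (Real.sqrt (E 0) * ∑ j : Fin k₀, 2 * Real.pi * ξ * (‖slotAmp W₁ j‖ + ‖slotAmp W₁ j‖)) with hA
  have hlinkW : ∀ k ∈ W, ∀ j s, ‖linkCoeff W₁ n k j s‖ ≤ 2 * Real.pi * ξ := by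
    intro k hk j s
    rw [hW, Finset.mem_insert, Finset.mem_singleton] at hk
    rcases hk with rfl | rfl
    · exact norm_linkCoeff_le_sqrt W₁ n _ j s
    · have h1 := norm_linkCoeff_le_sqrt W₁ n (-ℓ) j s; rwa [freqNormSq_neg] at h1
  have hAb : ∀ s ∈ Icc 0 T, ∑ k ∈ W, (‖modeRep W₁ n 𝔹 F u k s‖ * ∑ j, ‖linkCoeff W₁ n k j s‖ *
      (‖Complex.exp ((W₁.phase j).φ * Complex.I) * (1 / (2 * ((2 * Real.pi * ‖latticeVec (W₁.phase j).m‖ : ℝ) : ℂ) * Complex.I))‖ +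
       ‖starRingEnd ℂ (Complex.exp ((W₁.phase j).φ * Complex.I)) *
          (-(1 / (2 * ((2 * Real.pi * ‖latticeVec (W₁.phase j).m‖ : ℝ) : ℂ) * Complex.I)))‖)) ≤ A := by
    intro s hs
    have hterm : ∀ k ∈ W, ‖modeRep W₁ n 𝔹 F u k s‖ * ∑ j, ‖linkCoeff W₁ n k j s‖ *
        (‖Complex.exp ((W₁.phase j).φ * Complex.I) * (1 / (2 * ((2 * Real.pi * ‖latticeVec (W₁.phase j).m‖ : ℝ) : ℂ) * Complex.I))‖ +
         ‖starRingEnd ℂ (Complex.exp ((W₁.phase j).φ * Complex.I)) *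
            (-(1 / (2 * ((2 * Real.pi * ‖latticeVec (W₁.phase j).m‖ : ℝ) : ℂ) * Complex.I)))‖) ≤
        Real.sqrt (E 0) * ∑ j : Fin k₀, 2 * Real.pi * ξ * (‖slotAmp W₁ j‖ + ‖slotAmp W₁ j‖) := by
      intro k hk
      refine mul_le_mul (hxE k s hs) (Finset.sum_le_sum fun j _ => ?_) (Finset.sum_nonneg fun j _ => by positivity) (Real.sqrt_nonneg _)
      rw [hα j, hα' j]
      exact mul_le_mul_of_nonneg_right (hlinkW k hk j s) (by positivity)
    calc _ ≤ ∑ _k ∈ W, Real.sqrt (E 0) * ∑ j : Fin k₀, 2 * Real.pi * ξ * (‖slotAmp W₁ j‖ + ‖slotAmp W₁ j‖) := Finset.sum_le_sum hterm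
      _ = A := by
          rw [Finset.sum_const, show W.card = 2 by rw [hW]; exact Finset.card_pair hne, two_nsmul, hA]; ring
  -- the datum is carried by the block: `E 0 = ‖x_ℓ(0)‖² + ‖x_{−ℓ}(0)‖²`
  have hkd : ∀ k, kdot k (mFourierCoeff (FunctionSpaces.EuclideanSpace.complexify ∘ F) k) = 0 := by
    intro k
    rw [kdot_apply]
    exact FunctionSpaces.Torus.IsWeaklyDivFree.sum_mul_mFourierCoeff_eq_zero hF2 hFdiv k
  have hmode0 : ∀ k, modeRep W₁ n 𝔹 F u k 0 = mFourierCoeff (FunctionSpaces.EuclideanSpace.complexify ∘ F) k := by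
    intro k
    rw [modeRep_zero, transversalProj_eq_self_of_kdot_eq_zero k (hkd k)]
  have hZ0 : E 0 = ∑ k ∈ W, ‖modeRep W₁ n 𝔹 F u k 0‖ ^ 2 := by
    have hpars := hasSum_sq_norm_mFourierCoeff_complexify hF2
    have hfin : HasSum (fun k => ‖mFourierCoeff (EuclideanSpace.complexify ∘ F) k‖ ^ 2)
        (∑ k ∈ W, ‖mFourierCoeff (EuclideanSpace.complexify ∘ F) k‖ ^ 2) := by
      refine hasSum_sum_of_ne_finset_zero fun k hk => ?_
      rw [hW, Finset.mem_insert, Finset.mem_singleton, not_or] at hk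
      rw [hsupp k hk.1 hk.2, norm_zero, zero_pow two_ne_zero]
    rw [hE0, hpars.unique hfin]
    exact Finset.sum_congr rfl fun k _ => by rw [hmode0 k]
  -- fast-energy slaving: `Z s ≤ 4A²/dmin²`
  have key := fastEnergy_le_of_zero W₁ n hT.le h𝔹 h hFi hEae hQdom hEd hEac W hdmin hgap (pair_neighbours_not_mem W₁ hn hℓ) hAb hZ0 hs
  have hA0 : 0 ≤ A := by rw [hA]; exact mul_nonneg zero_le_two (mul_nonneg (Real.sqrt_nonneg _) (Finset.sum_nonneg fun j _ => by positivity))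
  have hZnn : 0 ≤ E s - ∑ k ∈ W, ‖modeRep W₁ n 𝔹 F u k s‖ ^ 2 := by
    have h1 := norm_sq_le_fastEnergy W₁ n hT h hFi hEc hEae W
      (k' := ℓ - fun i => (W₁.phase (⟨0, W₁.pos⟩ : Fin k₀)).m i * n)
      ((pair_neighbours_not_mem W₁ hn hℓ) ℓ hℓW ⟨0, W₁.pos⟩).1 s hs
    exact le_trans (sq_nonneg _) h1
  have hsqrtZ : Real.sqrt (E s - ∑ k ∈ W, ‖modeRep W₁ n 𝔹 F u k s‖ ^ 2) ≤ 2 * A / (2 * Real.pi ^ 2 * lo) := by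
    have h1 : 4 * A ^ 2 / (2 * Real.pi ^ 2 * lo) ^ 2 = (2 * A / (2 * Real.pi ^ 2 * lo)) ^ 2 := by field_simp; ring
    rw [← Real.sqrt_sq (show 0 ≤ 2 * A / (2 * Real.pi ^ 2 * lo) by positivity)]
    exact Real.sqrt_le_sqrt (key.trans (le_of_eq h1))
  -- every sideband of the slow mode is below `√Z`
  have hnb := pair_neighbours_not_mem W₁ hn hℓ ℓ hℓW
  have hside : ∀ k', k' ∉ W → ‖modeRep W₁ n 𝔹 F u k' s‖ ≤ 2 * A / (2 * Real.pi ^ 2 * lo) := by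
    intro k' hk'
    have h1 := norm_sq_le_fastEnergy W₁ n hT h hFi hEc hEae W hk' s hs
    have h2 : ‖modeRep W₁ n 𝔹 F u k' s‖ = Real.sqrt (‖modeRep W₁ n 𝔹 F u k' s‖ ^ 2) := (Real.sqrt_sq (norm_nonneg _)).symm
    rw [h2]
    exact (Real.sqrt_le_sqrt h1).trans hsqrtZ
  -- the link forcing, term by term
  have hterm : ∀ j : Fin k₀, ‖linkCoeff W₁ n ℓ j s • transversalProj ℓ
          ((Complex.exp ((W₁.phase j).φ * Complex.I) * (1 / (2 * ((2 * Real.pi * ‖latticeVec (W₁.phase j).m‖ : ℝ) : ℂ) * Complex.I))) •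
              modeRep W₁ n 𝔹 F u (ℓ - fun i => (W₁.phase j).m i * n) s +
            (starRingEnd ℂ (Complex.exp ((W₁.phase j).φ * Complex.I)) *
                (-(1 / (2 * ((2 * Real.pi * ‖latticeVec (W₁.phase j).m‖ : ℝ) : ℂ) * Complex.I)))) •
              modeRep W₁ n 𝔹 F u (ℓ + fun i => (W₁.phase j).m i * n) s)‖ ≤
        2 * Real.pi * ξ * ((‖slotAmp W₁ j‖ + ‖slotAmp W₁ j‖) * (2 * A / (2 * Real.pi ^ 2 * lo))) := by
    intro j
    rw [norm_smul]
    refine mul_le_mul (hlinkW ℓ hℓW j s) ?_ (norm_nonneg _) (by positivity)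
    refine (norm_transversalProj_le ℓ _).trans ((norm_add_le _ _).trans ?_)
    rw [norm_smul, norm_smul, hα j, hα' j, add_mul]
    exact add_le_add (mul_le_mul_of_nonneg_left (hside _ (hnb j).1) (norm_nonneg _))
      (mul_le_mul_of_nonneg_left (hside _ (hnb j).2) (norm_nonneg _))
  refine (norm_sum_le _ _).trans ((Finset.sum_le_sum fun j _ => hterm j).trans (le_of_eq ?_))
  -- bookkeeping of the constant
  have hS : ∑ j : Fin k₀, 2 * Real.pi * ξ * ((‖slotAmp W₁ j‖ + ‖slotAmp W₁ j‖) * (2 * A / (2 * Real.pi ^ 2 * lo))) =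
      (4 * Real.pi * ξ * (2 * A / (2 * Real.pi ^ 2 * lo))) * ∑ j, ‖slotAmp W₁ j‖ := by
    rw [Finset.mul_sum]; exact Finset.sum_congr rfl fun j _ => by ring
  have hAe : A = 8 * Real.pi * ξ * Real.sqrt (E 0) * ∑ j, ‖slotAmp W₁ j‖ := by
    have hS' : ∑ j : Fin k₀, 2 * Real.pi * ξ * (‖slotAmp W₁ j‖ + ‖slotAmp W₁ j‖) = 4 * Real.pi * ξ * ∑ j, ‖slotAmp W₁ j‖ := by
      rw [Finset.mul_sum]; exact Finset.sum_congr rfl fun j _ => by ring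
    rw [hA, hS']; ring
  rw [hS, hAe, hE0, hξ]
  have hpi : Real.pi ≠ 0 := Real.pi_pos.ne'
  field_simp
  ring

end Summit.AnomalousDissipation.AnomalousDissipation.Theorems.SolenoidalFractalHomogenisation.LagrangianStep.VmodGen

end
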